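import Summits.NavierStokesRegularity.NavierStokesRegularity.Theorems.StretchingWellBindingEnstrophyQuarterLawEnvelopeSparseness
import Summits.NavierStokesRegularity.NavierStokesRegularity.Theses.TypeIQuarterGate
import Summits.NavierStokesRegularity.NavierStokesRegularity.Theses.TypeILiouville
import HarnessLib

/-!
# Shelf crux `EnstrophyQuarterLaw` (stmt-NavierStokesRegularity-1574), line «sparse_sieve», BY NAME across routes:
# stub S2 (`UniformSparseness`) at every first blow-up from TIQG's scar split — 0056 ∧ `FiniteScarsTypeI` ∧ `ScarEnvelopeTypeI`

`--supports stmt-NavierStokesRegularity-1574 --as helper`; sequel to `…EnstrophyQuarterLawEnvelopeSparseness` (p819768: an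
any-rate multi-scar envelope plus finite energy gives `UniformSparseness T u`).

* `uniformSparseness_of_typeIRateEnvelope` — along a Leray–Hopf solution on `[0,T]`, `T > 0`, the conclusion of TIQG's
  `ScarEnvelopeTypeI` for that solution (`∃ σ C', ‖u(t,x)‖ ≤ C' + Σ_{a∈σ} C'/(‖x−a‖ + √(T−t))` on `[0,T) × ℝ³`; the sign of `C'`
  is free there — a negative `C'` is contradictory at `t = 0`) gives `UniformSparseness T u`;
* `stub_uniformSparseness_of_scarSplit` — BY NAME: `TypeILiouville.TypeIliouvilleNoTypeII` (stmt-0056 = stub 6 of the line),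
  `TypeIQuarterGate.FiniteScarsTypeI` (stmt-23842) and `TypeIQuarterGate.ScarEnvelopeTypeI` (stmt-23843) imply the registered
  signature of `stub_uniformSparseness` (S2 at every first blow-up).

READING. Locates the open stub S2∀ inside TIQG's split of K1: `S2∀ ⟸ 0056 ∧ 23842 ∧ 23843` directly (not through the quarter
law), next to `S2∀ ⟸ 0056 ∧ 24108` (Lorentz line, by composition through `EnstrophyQuarterLaw`). Implications between OPEN
statements; S2, 0056, 23842, 23843, `EnstrophyQuarterLaw` (1574) and Navier–Stokes regularity stay OPEN; no summit statement
is proved. [folklore]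
-/

noncomputable section

-- the summit and its single sub-problem share the name (CONVENTIONS §1), as in every Theorems file
set_option linter.dupNamespace false

namespace Summit.NavierStokesRegularity.NavierStokesRegularity.Theorems.EnstrophyQuarterLaw.EnvelopeSparseness

open MeasureTheory Set Metric
open Literature.Analysis Literature.Analysis.FluidPDE
open scoped ENNReal

/-- **S2 from a Type-I-rate scar envelope** (the conclusion shape of `TypeIQuarterGate.ScarEnvelopeTypeI`), along a
Leray–Hopf solution on `[0,T]` with `T > 0`: `UniformSparseness T u`. The rate `√(T−t)` enters only as a positive function;
a negative `C'` is excluded by the bound at `(t,x) = (0,0)`. [folklore] -/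
theorem uniformSparseness_of_typeIRateEnvelope {ν T : ℝ}
    {u : ℝ → EuclideanSpace ℝ (Fin 3) → EuclideanSpace ℝ (Fin 3)} (hν : 0 < ν) (hT : 0 < T)
    (hLH : IsLerayHopfOn T ν 0 (u 0) u)
    (henv : ∃ (σ : Finset (EuclideanSpace ℝ (Fin 3))) (C' : ℝ), ∀ t ∈ Ico 0 T, ∀ x,
      ‖u t x‖ ≤ C' + ∑ a ∈ σ, C' / (‖x - a‖ + Real.sqrt (T - t))) :
    SparseSieve.UniformSparseness T u := by
  obtain ⟨σ, C', h⟩ := henv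
  by_cases hC' : 0 ≤ C'
  · exact uniformSparseness_of_envelope_lerayHopf hν hLH σ hC' (fun t => Real.sqrt (T - t))
      (fun t ht => Real.sqrt_pos.2 (by linarith [ht.2])) h
  · exfalso
    have hlt : C' < 0 := not_le.1 hC'
    have h0 := h 0 ⟨le_rfl, hT⟩ 0
    have hsum : ∑ a ∈ σ, C' / (‖(0 : EuclideanSpace ℝ (Fin 3)) - a‖ + Real.sqrt (T - 0)) ≤ 0 :=
      Finset.sum_nonpos fun a _ => div_nonpos_of_nonpos_of_nonneg hlt.le (by positivity)
    have := norm_nonneg (u 0 0)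
    linarith

/-- **BY NAME: S2 at every first blow-up from 0056 and TIQG's scar split.** `TypeIliouvilleNoTypeII` (stmt-0056),
`FiniteScarsTypeI` (stmt-23842) and `ScarEnvelopeTypeI` (stmt-23843) imply the registered signature of the sparse-sieve stub
`stub_uniformSparseness` verbatim. Implication between OPEN statements. [folklore] -/
theorem stub_uniformSparseness_of_scarSplit
    (hS6 : Summit.NavierStokesRegularity.NavierStokesRegularity.Theses.TypeILiouville.TypeIliouvilleNoTypeII)
    (hscars : Summit.NavierStokesRegularity.NavierStokesRegularity.Theses.TypeIQuarterGate.FiniteScarsTypeI)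
    (henv : Summit.NavierStokesRegularity.NavierStokesRegularity.Theses.TypeIQuarterGate.ScarEnvelopeTypeI) :
    ∀ (ν T : ℝ), 0 < ν → 0 < T →
      ∀ (u : ℝ → EuclideanSpace ℝ (Fin 3) → EuclideanSpace ℝ (Fin 3))
        (p : ℝ → EuclideanSpace ℝ (Fin 3) → ℝ),
      IsMaximalSmoothSolution ν 0 u p T → IsLerayHopfOn T ν 0 (u 0) u →
      HasRapidSpatialDecay (u 0) → SparseSieve.UniformSparseness T u := by
  intro ν T hν hT u p hmax hLH hdec
  have hI := hS6 ν T hν hT u p hmax hLH hdec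
  have hσ := hscars ν T hν hT u p hmax hLH hdec hI
  exact uniformSparseness_of_typeIRateEnvelope hν hT hLH (henv ν T hν hT u p hmax hLH hdec hI hσ)

end Summit.NavierStokesRegularity.NavierStokesRegularity.Theorems.EnstrophyQuarterLaw.EnvelopeSparseness

end
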